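import Mathlib
import HarnessLib
import Summits.Ventures.LatticeQCDFlow.Scoring.BatchMeansVariance
import Summits.Ventures.LatticeQCDFlow.Scoring.BatchMeansCovarianceEnvelope

/-!
# The variance of the mean of the squared batch sums is `O(1/a)` — covariance sum included — under a
# geometric sup-norm envelope: `E_{μ₀}[(V − E V)²] ≤ (K₄ + K₆)/a`

HONEST FRAMING: exact (Metropolis-corrected) sampling algorithms for lattice gauge theory;
figures of merit are autocorrelation/cost numbers at stated couplings and volumes; no
continuum-physics claim.

Venture `LatticeQCDFlow` (cell pub-lqcd), topic `Scoring`; FANOUT row 8 (`s0-cpn-nemc`, GEN-20).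
NEW WORK of the cell, not a published result; no definition is introduced; nothing is cited as a
fact.  `Scoring/BatchMeansVarianceEnvelope.lean` summed the pair bound
`|E[U_j U_k] − E U_j E U_k| ≤ K₄ 1{j=k} + (K_dec K₂/b) ρ^{|j−k|}` to `K₄/a + K_dec K₂ ((1+ρ)/(1−ρ))/b`,
weakening the off-diagonal total `K_dec K₂ ((1+ρ)/(1−ρ))/(ab)` by `a ≥ 1`.  Weakening it by `b ≥ 1`
instead gives the `1/a` form below (same proof, GEN-19's, last step changed), which is what the
`O(1/a + 1/b²)` mean-square rate of the batch-means estimator needs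
(`Scoring/BatchMeansConsistencyRate.lean`).  Notation as in `Scoring/BatchMeansCovarianceEnvelope.lean`.

## Content

* **`chain_batchSq_mean_variance_le_inv_batches_of_envelope`** — `a, b ≥ 1`, every `μ₀`:
  `E_{μ₀}[((1/a) Σ_{j<a} U_j − (1/a) Σ_{j<a} E_{μ₀} U_j)²] ≤ (512 C_h⁴ + K_dec · 10 C_h² · (1+ρ)/(1−ρ))/a`
  (`C_h = 4CA/(1−ρ)`, `K_dec = 8 (2C)² A² (1+ρ)/(1−ρ)²`).

NOT CLAIMED: sharp constants; overlapping batches; unbounded observables.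
-/

noncomputable section

namespace Summit.Ventures.LatticeQCDFlow.Scoring

open MeasureTheory ProbabilityTheory Filter Finset Preorder Literature.Probability.MarkovChains
open scoped ENNReal Topology

variable {Ω : Type*} [MeasurableSpace Ω]

section Envelope

variable {κ : Kernel Ω Ω} [IsMarkovKernel κ] {π : Measure Ω} [IsProbabilityMeasure π] {A ρ : ℝ}

/-- **THE VARIANCE OF THE MEAN OF THE SQUARED BATCH SUMS, `1/a` form**: for every initial law `μ₀`,
`a ≥ 1`, `b ≥ 1`: `E_{μ₀}[((1/a) Σ_{j<a} U_j − (1/a) Σ_{j<a} E U_j)²] ≤ (K₄ + K_dec K₂ (1+ρ)/(1−ρ))/a`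
(the covariance sum is `O(1/(ab))`; `Scoring/BatchMeansVarianceEnvelope.lean` kept `O(1/b)`). -/
theorem chain_batchSq_mean_variance_le_inv_batches_of_envelope (henv : ∀ (g : Ω → ℝ), Measurable g → ∀ (Cg : ℝ), (∀ x, |g x| ≤ Cg) →
      ∀ (t : ℕ) (x : Ω), |(kop κ)^[t] g x - ∫ y, g y ∂π| ≤ 2 * Cg * (A * ρ ^ t))
    (hρ0 : 0 ≤ ρ) (hρ1 : ρ < 1)
    {f : Ω → ℝ} (hf : Measurable f) {C : ℝ} (hC : ∀ x, |f x| ≤ C)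
    (μ₀ : Measure Ω) [IsProbabilityMeasure μ₀] {a b : ℕ} (ha : a ≠ 0) (hb : b ≠ 0) :
    ∫ x, ((∑ j ∈ Finset.range a, (∑ i ∈ Finset.range b, (f (x (b * j + i)) - ∫ z, f z ∂π)) ^ 2 / b) / a
        - (∑ j ∈ Finset.range a, ∫ y, (∑ i ∈ Finset.range b, (f (y (b * j + i)) - ∫ z, f z ∂π)) ^ 2 / b
          ∂(Kernel.trajMeasure (X := fun _ : ℕ => Ω) μ₀
            (fun n : ℕ => κ.comap (fun h : (i : ↥(Finset.Iic n)) → Ω => h ⟨n, Finset.mem_Iic.2 le_rfl⟩)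
              (measurable_pi_apply _)))) / a) ^ 2
        ∂(Kernel.trajMeasure (X := fun _ : ℕ => Ω) μ₀
          (fun n : ℕ => κ.comap (fun h : (i : ↥(Finset.Iic n)) → Ω => h ⟨n, Finset.mem_Iic.2 le_rfl⟩)
            (measurable_pi_apply _)))
      ≤ (512 * (4 * C * A / (1 - ρ)) ^ 4
        + 8 * (2 * C) ^ 2 * A ^ 2 * ((1 + ρ) / (1 - ρ) ^ 2)
          * (10 * (4 * C * A / (1 - ρ)) ^ 2) * ((1 + ρ) / (1 - ρ))) / a := by
  set P := Kernel.trajMeasure (X := fun _ : ℕ => Ω) μ₀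
      (fun n : ℕ => κ.comap (fun h : (i : ↥(Finset.Iic n)) → Ω => h ⟨n, Finset.mem_Iic.2 le_rfl⟩)
        (measurable_pi_apply _)) with hP
  set c := ∫ z, f z ∂π with hc
  obtain ⟨hfb, hCfb, -⟩ := centred_observable_bounds π hf hC
  have ha0 : (0 : ℝ) < a := Nat.cast_pos.2 (Nat.pos_of_ne_zero ha)
  have hb0 : (0 : ℝ) < b := Nat.cast_pos.2 (Nat.pos_of_ne_zero hb)
  -- the squared batch sums `U j` and their means `m j`
  set U : ℕ → (ℕ → Ω) → ℝ := fun j x =>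
    (∑ i ∈ Finset.range b, (f (x (b * j + i)) - c)) ^ 2 / b with hU
  set m : ℕ → ℝ := fun j => ∫ y, U j y ∂P with hm
  have hUm : ∀ j, Measurable (U j) := fun j => (batchSq_bounded_measurable hfb hCfb b j).1
  have hUb : ∀ j x, |U j x| ≤ (b * (2 * C)) ^ 2 / b := fun j x =>
    (batchSq_bounded_measurable hfb hCfb b j).2 x
  set B : ℝ := (b * (2 * C)) ^ 2 / b with hB
  have hB0 : 0 ≤ B := by positivity
  have hmb : ∀ j, |m j| ≤ B := fun j => by
    calc |m j| = ‖∫ y, U j y ∂P‖ := (Real.norm_eq_abs _).symm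
      _ ≤ B * P.real Set.univ := norm_integral_le_of_norm_le_const (Eventually.of_forall fun y => by
          rw [Real.norm_eq_abs]; exact hUb j y)
      _ = B := by rw [probReal_univ, mul_one]
  -- centred versions `D j = U j − m j`
  have hDm : ∀ j, Measurable fun x => U j x - m j := fun j => (hUm j).sub measurable_const
  have hDb : ∀ j x, |U j x - m j| ≤ 2 * B := fun j x =>
    (abs_sub _ _).trans (by linarith [hUb j x, hmb j])
  have hiDD : ∀ j k, Integrable (fun x => (U j x - m j) * (U k x - m k)) P := fun j k =>
    integrable_of_bounded P ((hDm j).mul (hDm k)) (C := 2 * B * (2 * B)) fun x => by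
      rw [abs_mul]; exact mul_le_mul (hDb j x) (hDb k x) (abs_nonneg _) (by positivity)
  have hiUU : ∀ j k, Integrable (fun x => U j x * U k x) P := fun j k =>
    integrable_of_bounded P ((hUm j).mul (hUm k)) (C := B * B) fun x => by
      rw [abs_mul]; exact mul_le_mul (hUb j x) (hUb k x) (abs_nonneg _) hB0
  have hiU : ∀ j, Integrable (U j) P := fun j => integrable_of_bounded P (hUm j) (hUb j)
  -- `E[D_j D_k] = E[U_j U_k] − m_j m_k`
  have hcov : ∀ j k, ∫ x, (U j x - m j) * (U k x - m k) ∂P = ∫ x, U j x * U k x ∂P - m j * m k := by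
    intro j k
    have hpt : ∀ x, (U j x - m j) * (U k x - m k)
        = U j x * U k x - m k * U j x - m j * U k x + m j * m k := fun x => by ring
    have hi1 : Integrable (fun x => U j x * U k x - m k * U j x) P := (hiUU j k).sub ((hiU j).const_mul _)
    have hi2 : Integrable (fun x => U j x * U k x - m k * U j x - m j * U k x) P :=
      hi1.sub ((hiU k).const_mul _)
    rw [integral_congr_ae (ae_of_all _ hpt), integral_add hi2 (integrable_const _), integral_sub hi1
      ((hiU k).const_mul _), integral_sub (hiUU j k) ((hiU j).const_mul _), integral_const_mul,
      integral_const_mul, integral_const, probReal_univ, one_smul]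
    simp only [hm]
    ring
  -- the pair bound
  have hpair : ∀ j k, |∫ x, (U j x - m j) * (U k x - m k) ∂P|
      ≤ 512 * (4 * C * A / (1 - ρ)) ^ 4 * (if j = k then 1 else 0)
        + 8 * (2 * C) ^ 2 * A ^ 2 * ((1 + ρ) / (1 - ρ) ^ 2) * (10 * (4 * C * A / (1 - ρ)) ^ 2) / b
          * ρ ^ (Nat.dist j k) := by
    intro j k
    rw [hcov j k]
    have h := chain_batchSq_cov_le_of_envelope henv hρ0 hρ1 hf hC μ₀ hb j k
    rw [← hP] at h
    exact h
  -- expand the square of the centred mean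
  have hsq : ∀ x : ℕ → Ω, ((∑ j ∈ Finset.range a, U j x) / a - (∑ j ∈ Finset.range a, m j) / a) ^ 2
      = (∑ j ∈ Finset.range a, ∑ k ∈ Finset.range a, (U j x - m j) * (U k x - m k)) / (a : ℝ) ^ 2 := by
    intro x
    have h1 : (∑ j ∈ Finset.range a, U j x) / a - (∑ j ∈ Finset.range a, m j) / a
        = (∑ j ∈ Finset.range a, (U j x - m j)) / a := by
      rw [Finset.sum_sub_distrib, sub_div]
    rw [h1, div_pow, sq (∑ j ∈ Finset.range a, (U j x - m j)), Finset.sum_mul_sum]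
  show ∫ x, ((∑ j ∈ Finset.range a, U j x) / a - (∑ j ∈ Finset.range a, m j) / a) ^ 2 ∂P
    ≤ (512 * (4 * C * A / (1 - ρ)) ^ 4
      + 8 * (2 * C) ^ 2 * A ^ 2 * ((1 + ρ) / (1 - ρ) ^ 2) * (10 * (4 * C * A / (1 - ρ)) ^ 2)
        * ((1 + ρ) / (1 - ρ))) / a
  rw [integral_congr_ae (ae_of_all _ hsq), integral_div, integral_finsetSum _ fun j _ =>
    integrable_finsetSum _ fun k _ => hiDD j k]
  have hinner : ∀ j ∈ Finset.range a, ∫ x, ∑ k ∈ Finset.range a, (U j x - m j) * (U k x - m k) ∂P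
      = ∑ k ∈ Finset.range a, ∫ x, (U j x - m j) * (U k x - m k) ∂P := fun j _ =>
    integral_finsetSum _ fun k _ => hiDD j k
  rw [Finset.sum_congr rfl hinner]
  set K4 : ℝ := 512 * (4 * C * A / (1 - ρ)) ^ 4 with hK4
  set K5 : ℝ := 8 * (2 * C) ^ 2 * A ^ 2 * ((1 + ρ) / (1 - ρ) ^ 2) * (10 * (4 * C * A / (1 - ρ)) ^ 2) / b with hK5
  have hK50 : 0 ≤ K5 := by
    have : 0 ≤ (1 + ρ) / (1 - ρ) ^ 2 := div_nonneg (by linarith) (sq_nonneg _)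
    positivity
  have hsum : ∑ j ∈ Finset.range a, ∑ k ∈ Finset.range a, ∫ x, (U j x - m j) * (U k x - m k) ∂P
      ≤ a * K4 + K5 * (a * ((1 + ρ) / (1 - ρ))) := by
    calc ∑ j ∈ Finset.range a, ∑ k ∈ Finset.range a, ∫ x, (U j x - m j) * (U k x - m k) ∂P
        ≤ ∑ j ∈ Finset.range a, ∑ k ∈ Finset.range a,
            (K4 * (if j = k then 1 else 0) + K5 * ρ ^ (Nat.dist j k)) :=
          Finset.sum_le_sum fun j _ => Finset.sum_le_sum fun k _ => (le_abs_self _).trans (hpair j k)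
      _ = ∑ j ∈ Finset.range a, ∑ k ∈ Finset.range a, K4 * (if j = k then (1 : ℝ) else 0)
          + K5 * ∑ j ∈ Finset.range a, ∑ k ∈ Finset.range a, ρ ^ (Nat.dist j k) := by
          rw [Finset.mul_sum, ← Finset.sum_add_distrib]
          refine Finset.sum_congr rfl fun j _ => ?_
          rw [Finset.mul_sum, ← Finset.sum_add_distrib]
      _ = a * K4 + K5 * ∑ j ∈ Finset.range a, ∑ k ∈ Finset.range a, ρ ^ (Nat.dist j k) := by
          congr 1
          have hdiag : ∀ j ∈ Finset.range a,
              ∑ k ∈ Finset.range a, K4 * (if j = k then (1 : ℝ) else 0) = K4 := fun j hj => by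
            simp_rw [mul_ite, mul_one, mul_zero]
            rw [Finset.sum_ite_eq, if_pos hj]
          rw [Finset.sum_congr rfl hdiag, Finset.sum_const, Finset.card_range, nsmul_eq_mul]
      _ ≤ a * K4 + K5 * (a * ((1 + ρ) / (1 - ρ))) := by
          have := sum_sum_pow_dist_le hρ0 hρ1 a
          nlinarith
  calc (∑ j ∈ Finset.range a, ∑ k ∈ Finset.range a, ∫ x, (U j x - m j) * (U k x - m k) ∂P) / (a : ℝ) ^ 2
      ≤ (a * K4 + K5 * (a * ((1 + ρ) / (1 - ρ)))) / (a : ℝ) ^ 2 :=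
        div_le_div_of_nonneg_right hsum (by positivity)
    _ = K4 / a + K5 * ((1 + ρ) / (1 - ρ)) / a := by field_simp
    _ ≤ K4 / a + (8 * (2 * C) ^ 2 * A ^ 2 * ((1 + ρ) / (1 - ρ) ^ 2) * (10 * (4 * C * A / (1 - ρ)) ^ 2))
        * ((1 + ρ) / (1 - ρ)) / a := by
        have hb1 : (1 : ℝ) ≤ b := Nat.one_le_cast.2 (Nat.pos_of_ne_zero hb)
        have hK5le : K5 ≤ 8 * (2 * C) ^ 2 * A ^ 2 * ((1 + ρ) / (1 - ρ) ^ 2)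
            * (10 * (4 * C * A / (1 - ρ)) ^ 2) := by
          rw [hK5]
          refine div_le_self ?_ hb1
          have : 0 ≤ (1 + ρ) / (1 - ρ) ^ 2 := div_nonneg (by linarith) (sq_nonneg _)
          positivity
        have hr : 0 ≤ (1 + ρ) / (1 - ρ) := div_nonneg (by linarith) (by linarith)
        have := mul_le_mul_of_nonneg_right hK5le hr
        have := div_le_div_of_nonneg_right this ha0.le
        linarith
    _ = (K4 + 8 * (2 * C) ^ 2 * A ^ 2 * ((1 + ρ) / (1 - ρ) ^ 2) * (10 * (4 * C * A / (1 - ρ)) ^ 2)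
        * ((1 + ρ) / (1 - ρ))) / a := by
        rw [hK4]; ring


end Envelope

end Summit.Ventures.LatticeQCDFlow.Scoring

end
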